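import Summits.NavierStokesRegularity.NavierStokesRegularity.Theorems.ExtremiserTransienceDissipationLedgerDefs
import HarnessLib

/-!
# Route `ExtremiserTransience`, crux `NearExtremalTransiencePerFlow` (stmt-NavierStokesRegularity-26567),
# LINE g10-α «dissipation ledger», stub C2 `stub_ubiquityToLimit`: UBIQUITY PASSES TO POINTWISE LIMITS OF TRANSLATES

`--supports stmt-NavierStokesRegularity-26567` (registered stub C2 of the skeleton of record
`Cruxes/NearExtremalTransiencePerFlow/Lines/dissipation_ledger.lean`, sha a4e00292c54a; text of record `UbiquityToLimit` in
`Theorems/ExtremiserTransienceDissipationLedgerDefs.lean`).  Prover seat `ns-net-p1` (g11).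

THE STATEMENT (`UbiquityToLimit`).  If the fields `v n : ℝ³ → ℝ³` are smooth and equi-Lipschitz (`‖D¹(v n)‖ ≤ Λ₁`), the member
`v n` is ubiquitous about the centre `y n` up to radius `d n → ∞` at thickness `g` and level `η` (for every `0 ≤ r ≤ d n` some
`z` with `|‖z - y n‖ - r| ≤ g` and `η ≤ ‖v n z‖`), and the translates `v n (y n + ·)` converge pointwise to `w`, then `w` is
radially ubiquitous at thickness `g + 1` and level `η/2`.

PROOF.  Fix `r ≥ 0`; for `n ≥ N` we have `r ≤ d n`, so there are level points `z n` with recentred positions `ζ n = z n - y n`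
in the compact shell `S = { |‖ζ‖ - r| ≤ g }`.  A subsequence `ζ (φ n) → a ∈ S`.  By the mean value inequality
(`Convex.norm_image_sub_le_of_norm_fderiv_le`, `‖fderiv‖ = ‖D¹‖`), `‖v n (y n + a)‖ ≥ ‖v n (z n)‖ - Λ₁‖a - ζ n‖ ≥ η - Λ₁‖a - ζ n‖`
along the subsequence, whose right-hand side tends to `η` while the left-hand side tends to `‖w a‖`; hence `η ≤ ‖w a‖`, and a
fortiori `η/2 ≤ ‖w a‖`, `|‖a‖ - r| ≤ g ≤ g + 1`.  Elementary; nothing about Navier–Stokes is used.  No summit is proved by a line;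
crux 26567 and NS regularity stay OPEN. [folklore]
-/

noncomputable section

open scoped Topology ContDiff
open Filter Set Metric

namespace Summit.NavierStokesRegularity.NavierStokesRegularity.Theorems.NearExtremalTransiencePerFlow.DissipationLedger

-- the problem directory repeats the summit name (`NavierStokesRegularity/NavierStokesRegularity`)
set_option linter.dupNamespace false

/-- **Mean value inequality from a bound on the first iterated derivative.**  A smooth map with `‖D¹f‖ ≤ Λ` everywhere is
`Λ`-Lipschitz: `‖f a - f b‖ ≤ Λ‖a - b‖` (`‖fderiv ℝ f x‖ = ‖iteratedFDeriv ℝ 1 f x‖` and the mean value inequality on the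
convex set `univ`). [folklore] -/
theorem norm_sub_le_of_iteratedFDeriv_one_le {f : EuclideanSpace ℝ (Fin 3) → EuclideanSpace ℝ (Fin 3)} {Λ : ℝ}
    (hf : ContDiff ℝ (⊤ : ℕ∞) f) (hΛ : ∀ x, ‖iteratedFDeriv ℝ 1 f x‖ ≤ Λ) (a b : EuclideanSpace ℝ (Fin 3)) :
    ‖f a - f b‖ ≤ Λ * ‖a - b‖ := by
  have hd : ∀ x ∈ (Set.univ : Set (EuclideanSpace ℝ (Fin 3))), DifferentiableAt ℝ f x := fun x _ =>
    (hf.differentiable (by simp)).differentiableAt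
  have hb : ∀ x ∈ (Set.univ : Set (EuclideanSpace ℝ (Fin 3))), ‖fderiv ℝ f x‖ ≤ Λ := by
    intro x _
    have h := hΛ x
    rwa [← norm_iteratedFDeriv_fderiv (n := 0), norm_iteratedFDeriv_zero] at h
  exact convex_univ.norm_image_sub_le_of_norm_fderiv_le hd hb (Set.mem_univ b) (Set.mem_univ a)

/-- **C2 `stub_ubiquityToLimit` — UBIQUITY PASSES TO POINTWISE LIMITS OF TRANSLATES** (the registered stub C2 of LINE g10-α,
signature `UbiquityToLimit` verbatim the text of record).  Compactness of the shell `{ |‖ζ‖ - r| ≤ g }` (`IsCompact.tendsto_subseq`),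
the equi-Lipschitz bound (`norm_sub_le_of_iteratedFDeriv_one_le`) and `le_of_tendsto_of_tendsto`; the conclusion even holds with
thickness `g` and level `η`. [folklore] -/
theorem stub_ubiquityToLimit : UbiquityToLimit := by
  intro v Λ₁ g η y d w hcd hΛ hd hub hconv r hr
  -- eventually `r ≤ d n`
  obtain ⟨N, hN⟩ : ∃ N : ℕ, ∀ n, N ≤ n → r ≤ d n :=
    (hd.eventually (eventually_ge_atTop r)).exists_forall_of_atTop
  -- the level points of the members `n + N` near the sphere of radius `r` about `y (n + N)`, recentred
  have hz : ∀ n : ℕ, ∃ z : EuclideanSpace ℝ (Fin 3), |‖z - y (n + N)‖ - r| ≤ g ∧ η ≤ ‖v (n + N) z‖ :=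
    fun n => hub (n + N) r hr (hN (n + N) (Nat.le_add_left N n))
  choose z hzr hzη using hz
  set ζ : ℕ → EuclideanSpace ℝ (Fin 3) := fun n => z n - y (n + N) with hζ
  -- the shell is compact
  set S : Set (EuclideanSpace ℝ (Fin 3)) := {x | |‖x‖ - r| ≤ g} with hS
  have hScpt : IsCompact S := by
    have hclosed : IsClosed S := isClosed_le (by fun_prop) continuous_const
    have hbdd : Bornology.IsBounded S := by
      refine (Metric.isBounded_closedBall (x := (0 : EuclideanSpace ℝ (Fin 3))) (r := r + g)).subset ?_
      intro x hx
      rw [mem_closedBall, dist_zero_right]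
      have hx' : |‖x‖ - r| ≤ g := hx
      have h1 := (abs_le.1 hx').2
      linarith
    exact Metric.isCompact_of_isClosed_isBounded hclosed hbdd
  have hζS : ∀ n, ζ n ∈ S := fun n => hzr n
  obtain ⟨a, haS, φ, hφ, hlim⟩ := hScpt.tendsto_subseq hζS
  refine ⟨a, ?_, ?_⟩
  · -- `|‖a‖ - r| ≤ g ≤ g + 1`
    have hg : |‖a‖ - r| ≤ g := haS
    linarith
  · -- `η ≤ ‖w a‖` by the equi-Lipschitz bound along the subsequence
    have hT : Tendsto (fun n => ‖v (φ n + N) (y (φ n + N) + a)‖) atTop (𝓝 ‖w a‖) := by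
      have h1 : Tendsto (fun m => v m (y m + a)) atTop (𝓝 (w a)) := hconv a
      have h2 : Tendsto (fun n => φ n + N) atTop atTop := (tendsto_add_atTop_nat N).comp hφ.tendsto_atTop
      exact (h1.comp h2).norm
    have hB : Tendsto (fun n => η - Λ₁ * ‖a - ζ (φ n)‖) atTop (𝓝 (η - Λ₁ * 0)) := by
      have h1 : Tendsto (fun n => ‖a - ζ (φ n)‖) atTop (𝓝 0) := by
        have := (tendsto_const_nhds (x := a)).sub hlim
        rw [sub_self] at this
        exact tendsto_norm_zero.comp this
      exact tendsto_const_nhds.sub (h1.const_mul Λ₁)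
    rw [mul_zero, sub_zero] at hB
    have hle : ∀ n, η - Λ₁ * ‖a - ζ (φ n)‖ ≤ ‖v (φ n + N) (y (φ n + N) + a)‖ := by
      intro n
      have h1 := norm_sub_le_of_iteratedFDeriv_one_le (hcd (φ n + N)) (hΛ (φ n + N))
        (y (φ n + N) + a) (z (φ n))
      have h2 : y (φ n + N) + a - z (φ n) = a - ζ (φ n) := by
        simp only [hζ]; abel
      rw [h2] at h1
      have h3 := hzη (φ n)
      have h4 := norm_sub_norm_le (v (φ n + N) (z (φ n))) (v (φ n + N) (y (φ n + N) + a))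
      rw [norm_sub_rev] at h1
      linarith
    have hηle : η ≤ ‖w a‖ := le_of_tendsto_of_tendsto hB hT (Eventually.of_forall hle)
    rcases le_or_gt 0 η with h | h
    · linarith
    · linarith [norm_nonneg (w a)]

end Summit.NavierStokesRegularity.NavierStokesRegularity.Theorems.NearExtremalTransiencePerFlow.DissipationLedger

end
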